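import Summits.QuantumFields.QCD.Theses.QuarksAsStableAction

/-!
# Goldstone criterion for `IsChiralAtZero`
(crux `QuarksAsStableAction.StableActionBridge`, item stmt-QuantumFields-9737, line `Sketch`;
registered sub-goals G1 `ChiralCriterion` of the lead skeleton)

Since the statement re-type of 2026-08-16 the summit conjunct `QCDOf N_f` conjoins
`reg.IsChiralAtZero := ∀ ε > 0, ∃ m, (∀ f, 0 < m f) ∧ ¬ (reg.scheme m 0 0).HasLatticeMassGap ε`
("the lattice gap closes as `m → 0⁺`", Goldstone).  This file is the CONSUMPTION POINT of that
clause for every constructive route: it turns a two-point LOWER bound into the negation of the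
uniform lattice gap.

* `not_hasLatticeMassGap_of_slow_decay` — if along Euclidean-time separations `n_k ≤ L_k` with
  `a_k n_k → ∞` some connected two-point function is frequently `≥ c e^{−μ a_k n_k}` with `c > 0`
  and `μ < ε`, the scheme has no uniform lattice gap `ε`: the gap bound at `S = L_k`, `n = n_k`
  gives `c e^{(ε−μ) a_k n_k} ≤ C` frequently, while the left side tends to `+∞`.
* `hasLatticeMassGap_anti` — the gap clause is antitone in the rate (constant `max C 0`).
* `isChiralAtZero_of_goldstone` — the Goldstone criterion: slow decay at arbitrarily small rates
  at positive masses gives `IsChiralAtZero` (the previous lemma at `reg.scheme m 0 0`).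
* `not_isChiralAtZero_of_uniform_gap` — a uniform gap at all positive mass tuples refutes
  chirality at zero.
* `hasLatticeMassGap_scheme_iff` — the gap clause does not read the species renormalisations
  `z, shift` (definitional).

Pure filter / real-analysis bookkeeping over the tree's definitions (`QCDOS.lean`).
-/

open Filter Literature.MathematicalPhysics.QuantumFieldTheory

namespace Summit.QuantumFields.QCD.Cruxes.StableActionBridge.Sketch

/-- Exponential bookkeeping: from `c e^{−μ x} ≤ C e^{−ε x}` conclude `c e^{(ε−μ) x} ≤ C`. [folklore] -/
private theorem mul_exp_sub_le_of_le {c C μ ε x : ℝ}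
    (h : c * Real.exp (-(μ * x)) ≤ C * Real.exp (-(ε * x))) :
    c * Real.exp ((ε - μ) * x) ≤ C := by
  have hmul := mul_le_mul_of_nonneg_right h (Real.exp_pos (ε * x)).le
  calc c * Real.exp ((ε - μ) * x)
        = c * Real.exp (-(μ * x)) * Real.exp (ε * x) := by
          rw [mul_assoc, ← Real.exp_add]
          congr 1
          ring_nf
    _ ≤ C * Real.exp (-(ε * x)) * Real.exp (ε * x) := hmul
    _ = C := by rw [mul_assoc, ← Real.exp_add, neg_add_cancel, Real.exp_zero, mul_one]

/-- **Slow decay kills the uniform lattice gap.** If `μ < ε`, `c > 0`, and along Euclidean-time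
separations `n_k ≤ L_k` with `a_k n_k → ∞` the connected correlation of `A, B` on the torus of side
`2L_k + 1` is frequently at least `c e^{−μ a_k n_k}`, then the scheme does not have the uniform
lattice mass gap `ε`: the gap bound (at `S = L_k`, `n = n_k`) would give `c e^{(ε−μ) a_k n_k} ≤ C`
frequently, while `e^{(ε−μ) a_k n_k} → ∞`. [folklore] -/
theorem not_hasLatticeMassGap_of_slow_decay : ∀ (Nf : ℕ) (sch : QCDScheme Nf) (ε μ c : ℝ), μ < ε → 0 < c → ∀ (R R' : ℕ) (A : QCDLatticeObservable Nf R) (B : QCDLatticeObservable Nf R') (n : ℕ → ℕ), (∀ k, n k ≤ sch.L k) → Tendsto (fun k => sch.a k * n k) atTop atTop → (∃ᶠ k in atTop, c * Real.exp (-(μ * (sch.a k * n k))) ≤ ‖qcdLatticeConnectedCorr (sch.β k) (2 * sch.L k + 1) (fun fl => sch.mq fl k) A B (n k)‖) → ¬ sch.HasLatticeMassGap ε := by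
  intro Nf sch ε μ c hμε hc R R' A B n hnL hdiv hfreq hgap
  obtain ⟨C, hC⟩ := hgap R R' A B
  -- the gap bound on the torus of side `2 L_k + 1` at separation `n_k ≤ L_k`
  have hev : ∀ᶠ k in atTop,
      ‖qcdLatticeConnectedCorr (sch.β k) (2 * sch.L k + 1) (fun fl => sch.mq fl k) A B (n k)‖ ≤
        C * Real.exp (-(ε * (sch.a k * n k))) :=
    hC.mono fun k hk => hk (sch.L k) le_rfl (n k) (hnL k)
  -- `c e^{(ε−μ) a_k n_k} → ∞`, so it eventually exceeds `C`
  have hexp : Tendsto (fun k => c * Real.exp ((ε - μ) * (sch.a k * n k))) atTop atTop :=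
    (Real.tendsto_exp_atTop.comp (hdiv.const_mul_atTop (sub_pos.2 hμε))).const_mul_atTop hc
  have hgt : ∀ᶠ k in atTop, C < c * Real.exp ((ε - μ) * (sch.a k * n k)) :=
    hexp.eventually_gt_atTop C
  obtain ⟨k, hk₁, hk₂, hk₃⟩ := (hfreq.and_eventually (hev.and hgt)).exists
  exact absurd (mul_exp_sub_le_of_le (hk₁.trans hk₂)) (not_le.2 hk₃)

/-- **The uniform lattice gap is antitone in the rate**: a gap `Δ` is a gap `Δ' ≤ Δ` (with the
constant `max C 0`, using `0 ≤ a_k n`). [folklore] -/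
theorem hasLatticeMassGap_anti : ∀ (Nf : ℕ) (sch : QCDScheme Nf) (Δ Δ' : ℝ), Δ' ≤ Δ → sch.HasLatticeMassGap Δ → sch.HasLatticeMassGap Δ' := by
  intro Nf sch Δ Δ' hle hgap R R' A B
  obtain ⟨C, hC⟩ := hgap R R' A B
  refine ⟨max C 0, hC.mono fun k hk S hS n hn => (hk S hS n hn).trans ?_⟩
  have hx : 0 ≤ sch.a k * n := mul_nonneg (sch.a_pos k).le (Nat.cast_nonneg n)
  calc C * Real.exp (-(Δ * (sch.a k * n)))
        ≤ max C 0 * Real.exp (-(Δ * (sch.a k * n))) :=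
          mul_le_mul_of_nonneg_right (le_max_left _ _) (Real.exp_pos _).le
    _ ≤ max C 0 * Real.exp (-(Δ' * (sch.a k * n))) :=
          mul_le_mul_of_nonneg_left
            (Real.exp_le_exp.2 (neg_le_neg (mul_le_mul_of_nonneg_right hle hx))) (le_max_right _ _)

/-- **Goldstone criterion for chirality at zero.** If for every rate `ε > 0` there are positive
renormalised masses `m_f` at which, along the bare trajectory `m_f(k) = m_crit(k) + a_k m_f / Z_m(k)`,
some connected two-point function decays frequently no faster than `c e^{−μ a_k n_k}` with `μ < ε`
along separations `n_k ≤ L_k`, `a_k n_k → ∞` (a state lighter than `ε`: the pion), then the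
regularisation is chiral at zero. [folklore] -/
theorem isChiralAtZero_of_goldstone : ∀ (Nf : ℕ) (reg : QCDRegularisation Nf), (∀ ε : ℝ, 0 < ε → ∃ m : Fin Nf → ℝ, (∀ f, 0 < m f) ∧ ∃ μ c : ℝ, μ < ε ∧ 0 < c ∧ ∃ (R R' : ℕ) (A : QCDLatticeObservable Nf R) (B : QCDLatticeObservable Nf R') (n : ℕ → ℕ), (∀ k, n k ≤ reg.L k) ∧ Tendsto (fun k => reg.a k * n k) atTop atTop ∧ ∃ᶠ k in atTop, c * Real.exp (-(μ * (reg.a k * n k))) ≤ ‖qcdLatticeConnectedCorr (reg.β k) (2 * reg.L k + 1) (fun fl => reg.mcrit k + reg.a k * m fl / reg.Zm k) A B (n k)‖) → reg.IsChiralAtZero := by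
  intro Nf reg h ε hε
  obtain ⟨m, hm, μ, c, hμε, hc, R, R', A, B, n, hnL, hdiv, hfreq⟩ := h ε hε
  exact ⟨m, hm, not_hasLatticeMassGap_of_slow_decay Nf (reg.scheme m 0 0) ε μ c hμε hc R R' A B n
    hnL hdiv hfreq⟩

/-- **A uniform lattice gap at all positive mass tuples refutes chirality at zero.** [folklore] -/
theorem not_isChiralAtZero_of_uniform_gap : ∀ (Nf : ℕ) (reg : QCDRegularisation Nf), (∃ ε : ℝ, 0 < ε ∧ ∀ m : Fin Nf → ℝ, (∀ f, 0 < m f) → (reg.scheme m 0 0).HasLatticeMassGap ε) → ¬ reg.IsChiralAtZero := by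
  rintro Nf reg ⟨ε, hε, h⟩ hχ
  obtain ⟨m, hm, hng⟩ := hχ ε hε
  exact hng (h m hm)

/-- **The gap clause ignores the species renormalisations**: `HasLatticeMassGap` reads only
`β_k, L_k, a_k, m_f(k)` of the scheme, so at `reg.scheme m z shift` it is the clause at
`reg.scheme m 0 0` (definitional). [folklore] -/
theorem hasLatticeMassGap_scheme_iff : ∀ (Nf : ℕ) (reg : QCDRegularisation Nf) (m : Fin Nf → ℝ) (z shift : QCDField Nf → ℕ → ℝ) (Δ : ℝ), (reg.scheme m z shift).HasLatticeMassGap Δ ↔ (reg.scheme m 0 0).HasLatticeMassGap Δ :=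
  fun _ _ _ _ _ _ => Iff.rfl

end Summit.QuantumFields.QCD.Cruxes.StableActionBridge.Sketch
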